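import Summits.Ventures.YMGap.RobustBall.ThermodynamicVariance
import Literature.NumberTheory.Automorphic.ReciprocityGLnRestrictionProofs
import HarnessLib

/-!
# Venture YMGap, track ROBUST-BALL — BERNSTEIN BLOCKS IN THE CENTRED BOXES OF `ℤ^d` (geometry and the growth of the
# block parameters; no probability)

HONEST FRAMING. WHAT THIS IS: a venture file (cell `pub-ymgap`, track Y2 ROBUST-BALL, seat ds-3, theorems only): the lattice
bookkeeping behind the object «C-CLT». Inside the centred box `B_n = siteBox d n` (side `2n+1`) one places `K^d` translates
`z_c + B_m` (`c : Fin d → Fin K`) of the box of radius `m`, at mutual `ℓ^∞`-distance `≥ q + 1`, where `K (2m+1+q) ≤ 2n+1`: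
* `blockCentre`-free statements: with `z_c i = −n + m + c_i (2m+1+q)`, every translate lies in `B_n` (`add_mem_siteBox_of_le`),
  two translates with `c ≠ c'` are `q+1`-separated in the sup norm (`norm_sub_ge_of_ne`) hence disjoint, the translates have
  `#B_m = (2m+1)^d` sites each, and the box sum of any function splits as the sum over the blocks plus the sum over the
  remainder `B_n ∖ ⋃_c (z_c + B_m)`, whose cardinality is `(2n+1)^d − K^d (2m+1)^d`;
* ★ `exists_blockParams` — a choice `m n, q n, K n` (polylogarithmic blocks: `u = log₂(2n+1)`, `m = u⁴`, `q = u²`,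
  `K = ⌊(2n+1)/(2m+1+q)⌋`) with `K(2m+1+q) ≤ 2n+1`, `m → ∞`, `q → ∞`, `(2m+1)^d/√((2n+1)^d) → 0` (blocks are `o(√volume)`),
  `(K(2m+1))^d/(2n+1)^d → 1` (the blocks exhaust the volume), and `(2n+1)^{4d} e^{−c q} → 0` for every `c > 0` (the corridors
  beat any polynomial number of exponentially small dependence terms).
WHAT THIS IS NOT: no measure, no observable; nothing about the continuum or the Clay problem.
References: S. N. Bernstein, Math. Ann. 97 (1927) 1–59 (the blocking method); I. A. Ibragimov, Yu. V. Linnik (1971), Ch. 18.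
-/

noncomputable section

open Filter Topology Finset
open Literature.Probability.LatticeModels

namespace Summit.Ventures.YMGap.RobustBall

namespace BoxBlocks

variable {d : ℕ}

/-! ### Translates of the small box inside the big box -/

/-- Membership in a translate: `x ∈ (B_m).image (· + z) ↔ x − z ∈ B_m`. [folklore] -/
theorem mem_image_add_iff {m : ℕ} {z x : Site d} :
    x ∈ (siteBox d m).image (fun y => y + z) ↔ x - z ∈ siteBox d m := by
  constructor
  · rintro hx
    obtain ⟨y, hy, rfl⟩ := Finset.mem_image.1 hx
    simpa using hy
  · intro hx
    exact Finset.mem_image.2 ⟨x - z, hx, by simp⟩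

/-- A translate of `B_m` has `(2m+1)^d` sites. [folklore] -/
theorem card_image_add (m : ℕ) (z : Site d) : ((siteBox d m).image (fun y => y + z)).card = (2 * m + 1) ^ d := by
  rw [Finset.card_image_of_injective _ (add_left_injective z), ThermodynamicVariance.card_siteBox]

/-- **A translate `z + B_m` lies in `B_n`** as soon as `−n + m ≤ z_i ≤ n − m` for every coordinate. [folklore] -/
theorem image_add_subset_siteBox {m n : ℕ} {z : Site d} (hz : ∀ i, -(n : ℤ) + m ≤ z i ∧ z i + m ≤ n) :
    (siteBox d m).image (fun y => y + z) ⊆ siteBox d n := by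
  intro x hx
  rw [mem_image_add_iff, mem_siteBox] at hx
  rw [mem_siteBox]
  intro i
  have h := hx i
  simp only [Pi.sub_apply] at h
  obtain ⟨h1, h2⟩ := abs_le.1 h
  obtain ⟨hz1, hz2⟩ := hz i
  exact abs_le.2 ⟨by linarith, by linarith⟩

/-- **Separation of two translates**: if `|z_i − z'_i| ≥ 2m + 1 + q` in ONE coordinate `i`, then every `x ∈ z + B_m` and
`y ∈ z' + B_m` satisfy `‖x − y‖_∞ ≥ q + 1`. [folklore] -/
theorem norm_sub_ge_of_apart {m q : ℕ} {z z' x y : Site d} {i : Fin d} (hzz : (2 * m + 1 + q : ℤ) ≤ |z i - z' i|)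
    (hx : x ∈ (siteBox d m).image (fun y => y + z)) (hy : y ∈ (siteBox d m).image (fun y => y + z')) :
    (q : ℝ) + 1 ≤ ‖x - y‖ := by
  rw [mem_image_add_iff, mem_siteBox] at hx hy
  have h1 := hx i
  have h2 := hy i
  simp only [Pi.sub_apply] at h1 h2
  have hint : (q : ℤ) + 1 ≤ |x i - y i| := by
    rw [abs_le] at h1 h2
    rcases le_abs.1 hzz with h | h
    · exact le_abs.2 (Or.inl (by linarith))
    · exact le_abs.2 (Or.inr (by linarith))
  have hci : (q : ℝ) + 1 ≤ ‖(x - y) i‖ := by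
    rw [Pi.sub_apply, Int.norm_eq_abs]
    push_cast
    have h := hint
    rw [← Int.cast_le (R := ℝ)] at h
    push_cast at h
    exact h
  exact hci.trans (norm_le_pi_norm (x - y) i)

/-! ### The explicit block centres `z_c i = −n + m + c_i (2m+1+q)` -/

/-- **The explicit centres keep the blocks inside `B_n`** when `K (2m+1+q) ≤ 2n+1`. [folklore] -/
theorem centre_bounds {n m q K : ℕ} (hK : K * (2 * m + 1 + q) ≤ 2 * n + 1) (c : Fin d → Fin K) (i : Fin d) :
    -(n : ℤ) + m ≤ (-(n : ℤ) + m + (c i : ℕ) * (2 * m + 1 + q : ℕ)) ∧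
      (-(n : ℤ) + m + (c i : ℕ) * (2 * m + 1 + q : ℕ)) + m ≤ n := by
  refine ⟨?_, ?_⟩
  · have h0 : (0 : ℤ) ≤ ((c i : ℕ) : ℤ) * ((2 * m + 1 + q : ℕ) : ℤ) := by positivity
    linarith
  have hc : (c i : ℕ) + 1 ≤ K := (c i).2
  have h1 : ((c i : ℕ) + 1) * (2 * m + 1 + q) ≤ 2 * n + 1 := (Nat.mul_le_mul_right _ hc).trans hK
  have h2 : ((c i : ℕ) : ℤ) * (2 * m + 1 + q : ℕ) + (2 * m + 1 + q : ℕ) ≤ 2 * n + 1 := by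
    have := h1; rw [add_mul, one_mul] at this; exact_mod_cast this
  push_cast at h2 ⊢
  linarith

/-- **Distinct explicit centres are `2m+1+q` apart in some coordinate.** [folklore] -/
theorem exists_apart_of_ne {n m q K : ℕ} {c c' : Fin d → Fin K} (h : c ≠ c') :
    ∃ i, (2 * m + 1 + q : ℤ) ≤ |(-(n : ℤ) + m + (c i : ℕ) * (2 * m + 1 + q : ℕ)) -
      (-(n : ℤ) + m + (c' i : ℕ) * (2 * m + 1 + q : ℕ))| := by
  obtain ⟨i, hi⟩ := Function.ne_iff.1 h
  refine ⟨i, ?_⟩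
  have hne : (c i : ℕ) ≠ (c' i : ℕ) := fun e => hi (Fin.ext e)
  rw [show (-(n : ℤ) + m + (c i : ℕ) * (2 * m + 1 + q : ℕ)) - (-(n : ℤ) + m + (c' i : ℕ) * (2 * m + 1 + q : ℕ)) =
    (((c i : ℕ) : ℤ) - (c' i : ℕ)) * (2 * m + 1 + q : ℕ) by ring, abs_mul, Nat.abs_cast]
  have h1 : (1 : ℤ) ≤ |((c i : ℕ) : ℤ) - (c' i : ℕ)| := by
    rcases lt_or_gt_of_ne hne with hlt | hlt
    · rw [abs_of_neg (by omega)]; omega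
    · rw [abs_of_pos (by omega)]; omega
  calc (2 * m + 1 + q : ℤ) = 1 * (2 * m + 1 + q : ℕ) := by push_cast; ring
    _ ≤ |((c i : ℕ) : ℤ) - (c' i : ℕ)| * (2 * m + 1 + q : ℕ) := by gcongr

/-! ### The block family: separation, disjointness, cardinality of the remainder, splitting of box sums -/

section Family

variable {n m q K : ℕ}

/-- The block with multi-index `c`. (Local abbreviation inside proofs: `blk c = (B_m).image (· + z_c)`.) Two blocks with `c ≠ c'`
are `q+1`-separated in the sup norm. [folklore] -/
theorem blocks_apart (hK : K * (2 * m + 1 + q) ≤ 2 * n + 1) {c c' : Fin d → Fin K} (h : c ≠ c') {x y : Site d}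
    (hx : x ∈ (siteBox d m).image (fun y => y + fun i => -(n : ℤ) + m + (c i : ℕ) * (2 * m + 1 + q : ℕ)))
    (hy : y ∈ (siteBox d m).image (fun y => y + fun i => -(n : ℤ) + m + (c' i : ℕ) * (2 * m + 1 + q : ℕ))) :
    (q : ℝ) + 1 ≤ ‖x - y‖ := by
  have _ := hK
  obtain ⟨i, hi⟩ := exists_apart_of_ne (n := n) (m := m) (q := q) h
  exact norm_sub_ge_of_apart (i := i) hi hx hy

/-- Distinct blocks are disjoint. [folklore] -/
theorem blocks_disjoint (hK : K * (2 * m + 1 + q) ≤ 2 * n + 1) {c c' : Fin d → Fin K} (h : c ≠ c') :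
    Disjoint ((siteBox d m).image (fun y => y + fun i => -(n : ℤ) + m + (c i : ℕ) * (2 * m + 1 + q : ℕ)))
      ((siteBox d m).image (fun y => y + fun i => -(n : ℤ) + m + (c' i : ℕ) * (2 * m + 1 + q : ℕ))) := by
  rw [Finset.disjoint_left]
  intro x hx hx'
  have h := blocks_apart hK h hx hx'
  simp at h
  linarith

/-- Every block lies in `B_n`. [folklore] -/
theorem block_subset (hK : K * (2 * m + 1 + q) ≤ 2 * n + 1) (c : Fin d → Fin K) :
    (siteBox d m).image (fun y => y + fun i => -(n : ℤ) + m + (c i : ℕ) * (2 * m + 1 + q : ℕ)) ⊆ siteBox d n :=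
  image_add_subset_siteBox fun i => centre_bounds hK c i

/-- The union of the blocks lies in `B_n` and has `K^d (2m+1)^d` sites. [folklore] -/
theorem card_biUnion_blocks (hK : K * (2 * m + 1 + q) ≤ 2 * n + 1) :
    (Finset.univ.biUnion fun c : Fin d → Fin K =>
        (siteBox d m).image (fun y => y + fun i => -(n : ℤ) + m + (c i : ℕ) * (2 * m + 1 + q : ℕ))).card =
      K ^ d * (2 * m + 1) ^ d := by
  rw [Finset.card_biUnion (fun c _ c' _ h => blocks_disjoint hK h)]
  simp only [card_image_add, Finset.sum_const, Finset.card_univ, smul_eq_mul, Fintype.card_fun, Fintype.card_fin]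

/-- **Cardinality of the remainder**: `#(B_n ∖ ⋃_c block_c) = (2n+1)^d − K^d (2m+1)^d`. [folklore] -/
theorem card_remainder (hK : K * (2 * m + 1 + q) ≤ 2 * n + 1) :
    (siteBox d n \ Finset.univ.biUnion fun c : Fin d → Fin K =>
        (siteBox d m).image (fun y => y + fun i => -(n : ℤ) + m + (c i : ℕ) * (2 * m + 1 + q : ℕ))).card =
      (2 * n + 1) ^ d - K ^ d * (2 * m + 1) ^ d := by
  rw [Finset.card_sdiff_of_subset (Finset.biUnion_subset.2 fun c _ => block_subset hK c), ThermodynamicVariance.card_siteBox,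
    card_biUnion_blocks hK]

/-- `K^d (2m+1)^d ≤ (2n+1)^d`: the blocks fit. [folklore] -/
theorem blocks_card_le (hK : K * (2 * m + 1 + q) ≤ 2 * n + 1) : K ^ d * (2 * m + 1) ^ d ≤ (2 * n + 1) ^ d := by
  have h := Finset.card_le_card (Finset.biUnion_subset.2 fun c (_ : c ∈ (Finset.univ : Finset (Fin d → Fin K))) =>
    block_subset (d := d) hK c)
  rwa [card_biUnion_blocks hK, ThermodynamicVariance.card_siteBox] at h

/-- **Splitting a box sum over the blocks and the remainder**: for any `g : Site d → M` into an additive commutative monoid,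
`Σ_{x∈B_n} g x = Σ_c Σ_{x ∈ block_c} g x + Σ_{x ∈ remainder} g x`. [folklore] -/
theorem sum_siteBox_eq_blocks_add_remainder {M : Type*} [AddCommMonoid M] (hK : K * (2 * m + 1 + q) ≤ 2 * n + 1)
    (g : Site d → M) :
    ∑ x ∈ siteBox d n, g x =
      (∑ c : Fin d → Fin K, ∑ x ∈ (siteBox d m).image (fun y => y + fun i => -(n : ℤ) + m + (c i : ℕ) * (2 * m + 1 + q : ℕ)),
          g x) +
        ∑ x ∈ (siteBox d n \ Finset.univ.biUnion fun c : Fin d → Fin K =>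
          (siteBox d m).image (fun y => y + fun i => -(n : ℤ) + m + (c i : ℕ) * (2 * m + 1 + q : ℕ))), g x := by
  have hsub : (Finset.univ.biUnion fun c : Fin d → Fin K =>
      (siteBox d m).image (fun y => y + fun i => -(n : ℤ) + m + (c i : ℕ) * (2 * m + 1 + q : ℕ))) ⊆ siteBox d n :=
    Finset.biUnion_subset.2 fun c _ => block_subset hK c
  rw [← Finset.sum_sdiff hsub, add_comm, Finset.sum_biUnion (fun c _ c' _ h => blocks_disjoint hK h)]

/-- A block sum is the translated small-box sum: `Σ_{x ∈ (B_m).image (·+z)} g x = Σ_{y ∈ B_m} g (y + z)`. [folklore] -/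
theorem sum_image_add {M : Type*} [AddCommMonoid M] (m : ℕ) (z : Site d) (g : Site d → M) :
    ∑ x ∈ (siteBox d m).image (fun y => y + z), g x = ∑ y ∈ siteBox d m, g (y + z) :=
  Finset.sum_image fun _ _ _ _ h => add_left_injective z h

end Family

/-! ### Growth of the polylogarithmic block parameters -/

/-- `log₂ (2n+1) → ∞`. [folklore] -/
theorem tendsto_log_two_atTop : Tendsto (fun n : ℕ => Nat.log 2 (2 * n + 1)) atTop atTop := by
  refine tendsto_atTop_atTop.2 fun k => ⟨2 ^ k, fun n hn => ?_⟩
  exact Nat.le_log_of_pow_le (by norm_num) (by omega)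

/-- `2^{log₂ N} ≤ N < 2^{log₂ N + 1}` in the reals, `N = 2n+1`. [folklore] -/
theorem two_pow_log_le (n : ℕ) :
    (2 : ℝ) ^ Nat.log 2 (2 * n + 1) ≤ (2 * n + 1 : ℝ) ∧ (2 * n + 1 : ℝ) < (2 : ℝ) ^ (Nat.log 2 (2 * n + 1) + 1) := by
  constructor
  · have h := Nat.pow_log_le_self 2 (x := 2 * n + 1) (by omega)
    exact_mod_cast h
  · have h := Nat.lt_pow_succ_log_self (b := 2) (by norm_num) (2 * n + 1)
    exact_mod_cast h

/-- Polylog over root: `(3u⁴)^d / (√2)^{u d}... concretely `(3 u^4 / (√2)^u)^d → 0` along `u → ∞`. [folklore] -/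
theorem tendsto_polylog_div_sqrt_pow (d : ℕ) (hd : 1 ≤ d) :
    Tendsto (fun u : ℕ => ((3 : ℝ) * (u : ℝ) ^ 4 / Real.sqrt 2 ^ u) ^ d) atTop (𝓝 0) := by
  have h1 : Tendsto (fun u : ℕ => (u : ℝ) ^ 4 / Real.sqrt 2 ^ u) atTop (𝓝 0) :=
    tendsto_pow_const_div_const_pow_of_one_lt 4 (by
      rw [show (1 : ℝ) = Real.sqrt 1 by simp]; exact Real.sqrt_lt_sqrt zero_le_one (by norm_num))
  have h2 : Tendsto (fun u : ℕ => (3 : ℝ) * ((u : ℝ) ^ 4 / Real.sqrt 2 ^ u)) atTop (𝓝 0) := by simpa using h1.const_mul 3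
  have h3 := h2.pow d
  rw [zero_pow (by omega)] at h3
  refine h3.congr fun u => ?_
  ring

/-- **`(2^{4d} e^{−c u})^u`-type decay**: for `c > 0`, `2^{4d(u+1)} · e^{−c u²} → 0` as `u → ∞`. [folklore] -/
theorem tendsto_two_pow_mul_exp_neg_sq (d : ℕ) {c : ℝ} (hc : 0 < c) :
    Tendsto (fun u : ℕ => (2 : ℝ) ^ (4 * d * (u + 1)) * Real.exp (-c * (u : ℝ) ^ 2)) atTop (𝓝 0) := by
  -- `2^{4d(u+1)} e^{−cu²} = 2^{4d} · (2^{4d} e^{−cu})^u` and `2^{4d} e^{−cu} ≤ 1/2` eventually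
  have hr : Tendsto (fun u : ℕ => (2 : ℝ) ^ (4 * d) * Real.exp (-c * u)) atTop (𝓝 0) := by
    have h : Tendsto (fun u : ℕ => Real.exp (-c * u)) atTop (𝓝 0) := by
      have := (Real.tendsto_exp_neg_atTop_nhds_zero).comp ((tendsto_natCast_atTop_atTop (R := ℝ)).const_mul_atTop hc)
      refine this.congr fun u => ?_
      simp [Function.comp, neg_mul]
    simpa using h.const_mul ((2 : ℝ) ^ (4 * d))
  have hev : ∀ᶠ u : ℕ in atTop, (2 : ℝ) ^ (4 * d) * Real.exp (-c * u) ≤ 1 / 2 := by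
    filter_upwards [(Metric.tendsto_nhds.1 hr) (1 / 2) (by norm_num)] with u hu
    rw [Real.dist_eq, sub_zero, abs_of_nonneg (by positivity)] at hu
    exact hu.le
  have hgeom : Tendsto (fun u : ℕ => (2 : ℝ) ^ (4 * d) * (1 / 2 : ℝ) ^ u) atTop (𝓝 0) := by
    simpa using (tendsto_pow_atTop_nhds_zero_of_lt_one (by norm_num : (0 : ℝ) ≤ 1 / 2) (by norm_num)).const_mul
      ((2 : ℝ) ^ (4 * d))
  refine squeeze_zero' (Eventually.of_forall fun u => by positivity) ?_ hgeom
  filter_upwards [hev] with u hu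
  have h2 : (2 : ℝ) ^ (4 * d * (u + 1)) = (2 : ℝ) ^ (4 * d) * ((2 : ℝ) ^ (4 * d)) ^ u := by
    rw [← pow_mul, ← pow_add]; congr 1; ring
  have h3 : Real.exp (-c * (u : ℝ) ^ 2) = Real.exp (-c * u) ^ u := by
    rw [← Real.exp_nat_mul]; congr 1; ring
  rw [h2, h3, mul_assoc, ← mul_pow]
  gcongr

/-- ★ **THE POLYLOGARITHMIC BLOCK PARAMETERS.** For `d ≥ 1` there are `m, q, K : ℕ → ℕ` (namely `u = log₂(2n+1)`, `m = u⁴`,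
`q = u²`, `K = ⌊(2n+1)/(2m+1+q)⌋`) with: (i) `K(2m+1+q) ≤ 2n+1`; (ii) `m → ∞`; (iii) `q → ∞`;
(iv) `(2m+1)^d / √((2n+1)^d) → 0`; (v) `(K(2m+1))^d / (2n+1)^d → 1`; (vi) `(2n+1)^{4d} e^{−c q} → 0` for every `c > 0`. [folklore] -/
theorem exists_blockParams (d : ℕ) (hd : 1 ≤ d) : ∃ m q K : ℕ → ℕ,
    (∀ n, K n * (2 * m n + 1 + q n) ≤ 2 * n + 1) ∧ Tendsto m atTop atTop ∧ Tendsto q atTop atTop ∧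
    Tendsto (fun n => ((2 * m n + 1 : ℕ) : ℝ) ^ d / Real.sqrt (((2 * n + 1 : ℕ) : ℝ) ^ d)) atTop (𝓝 0) ∧
    Tendsto (fun n => ((K n * (2 * m n + 1) : ℕ) : ℝ) ^ d / ((2 * n + 1 : ℕ) : ℝ) ^ d) atTop (𝓝 1) ∧
    ∀ c : ℝ, 0 < c → Tendsto (fun n => ((2 * n + 1 : ℕ) : ℝ) ^ (4 * d) * Real.exp (-c * q n)) atTop (𝓝 0) := by
  set u : ℕ → ℕ := fun n => Nat.log 2 (2 * n + 1) with hu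
  have hut : Tendsto u atTop atTop := tendsto_log_two_atTop
  refine ⟨fun n => u n ^ 4, fun n => u n ^ 2, fun n => (2 * n + 1) / (2 * u n ^ 4 + 1 + u n ^ 2), fun n => Nat.div_mul_le_self _ _,
    ?_, ?_, ?_, ?_, ?_⟩
  · exact (tendsto_pow_atTop (by norm_num : (4 : ℕ) ≠ 0)).comp hut
  · exact (tendsto_pow_atTop (by norm_num : (2 : ℕ) ≠ 0)).comp hut
  · -- (iv): `(2u⁴+1)^d/√(N^d) ≤ (3u⁴/(√2)^u)^d` for `u ≥ 1`
    have hlim := (tendsto_polylog_div_sqrt_pow d hd).comp hut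
    have hev : ∀ᶠ n : ℕ in atTop, 1 ≤ u n := hut.eventually_ge_atTop 1
    refine squeeze_zero' (Eventually.of_forall fun n => by positivity) ?_ hlim
    filter_upwards [hev] with n hn
    have hN := (two_pow_log_le n).1
    have hu1 : (1 : ℝ) ≤ u n := by exact_mod_cast hn
    have hsqrtN : Real.sqrt 2 ^ u n ≤ Real.sqrt ((2 * n + 1 : ℕ) : ℝ) := by
      rw [← Literature.NumberTheory.Automorphic.real_sqrt_pow (by norm_num : (0 : ℝ) ≤ 2)]
      exact Real.sqrt_le_sqrt (by exact_mod_cast hN)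
    have hnum : ((2 * u n ^ 4 + 1 : ℕ) : ℝ) ≤ 3 * (u n : ℝ) ^ 4 := by
      push_cast; nlinarith [one_le_pow₀ (M₀ := ℝ) hu1 (n := 4)]
    simp only [Function.comp]
    rw [Literature.NumberTheory.Automorphic.real_sqrt_pow (by positivity), ← div_pow]
    have hpos : 0 < Real.sqrt 2 ^ u n := by positivity
    have hkey : ((2 * u n ^ 4 + 1 : ℕ) : ℝ) / Real.sqrt ((2 * n + 1 : ℕ) : ℝ) ≤ 3 * (u n : ℝ) ^ 4 / Real.sqrt 2 ^ u n := by
      rw [div_le_div_iff₀ (lt_of_lt_of_le hpos hsqrtN) hpos]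
      calc ((2 * u n ^ 4 + 1 : ℕ) : ℝ) * Real.sqrt 2 ^ u n ≤ 3 * (u n : ℝ) ^ 4 * Real.sqrt 2 ^ u n := by gcongr
        _ ≤ 3 * (u n : ℝ) ^ 4 * Real.sqrt ((2 * n + 1 : ℕ) : ℝ) := by gcongr
    exact pow_le_pow_left₀ (by positivity) hkey d
  · -- (v): `1 − 1/(2u²) − 3u⁴/2^u ≤ (2m+1)/L − (2m+1)/N ≤ K(2m+1)/N ≤ 1`
    have hlow : Tendsto (fun v : ℕ => (1 : ℝ) - 1 / (2 * (v : ℝ) ^ 2) - 3 * (v : ℝ) ^ 4 / 2 ^ v) atTop (𝓝 1) := by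
      have h1 : Tendsto (fun v : ℕ => (1 : ℝ) / (2 * (v : ℝ) ^ 2)) atTop (𝓝 0) :=
        tendsto_const_nhds.div_atTop (Tendsto.const_mul_atTop (by norm_num)
          ((tendsto_pow_atTop two_ne_zero).comp tendsto_natCast_atTop_atTop))
      have h2 : Tendsto (fun v : ℕ => 3 * (v : ℝ) ^ 4 / 2 ^ v) atTop (𝓝 0) := by
        simpa [mul_div_assoc] using (tendsto_pow_const_div_const_pow_of_one_lt 4 (one_lt_two (α := ℝ))).const_mul 3
      simpa using (tendsto_const_nhds.sub h1).sub h2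
    have hratio : Tendsto (fun n => ((((2 * n + 1) / (2 * u n ^ 4 + 1 + u n ^ 2) * (2 * u n ^ 4 + 1) : ℕ) : ℝ)) /
        ((2 * n + 1 : ℕ) : ℝ)) atTop (𝓝 1) := by
      refine tendsto_of_tendsto_of_tendsto_of_le_of_le' (hlow.comp hut) tendsto_const_nhds ?_ (Eventually.of_forall fun n => ?_)
      · filter_upwards [hut.eventually_ge_atTop 1] with n hn
        simp only [Function.comp]
        set N : ℕ := 2 * n + 1 with hNdef
        set L : ℕ := 2 * u n ^ 4 + 1 + u n ^ 2 with hLdef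
        have hu1 : (1 : ℝ) ≤ u n := by exact_mod_cast hn
        have hL0 : (0 : ℝ) < L := by rw [hLdef]; positivity
        have hN0 : (0 : ℝ) < N := by rw [hNdef]; positivity
        have hKL : (N : ℝ) - L ≤ ((N / L : ℕ) : ℝ) * L := by
          have h := Nat.div_add_mod N L
          have hmod := Nat.mod_lt N (show 0 < L by rw [hLdef]; positivity)
          have h' : ((L * (N / L) + N % L : ℕ) : ℝ) = N := by exact_mod_cast h
          push_cast at h'
          have hmod' : ((N % L : ℕ) : ℝ) < L := by exact_mod_cast hmod
          nlinarith
        have hstep1 : ((2 * u n ^ 4 + 1 : ℕ) : ℝ) / L - ((2 * u n ^ 4 + 1 : ℕ) : ℝ) / N ≤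
            (((N / L : ℕ) * (2 * u n ^ 4 + 1) : ℕ) : ℝ) / N := by
          rw [div_sub_div _ _ hL0.ne' hN0.ne', div_le_div_iff₀ (mul_pos hL0 hN0) hN0]
          push_cast
          have h0 : (0 : ℝ) ≤ (2 * (u n : ℝ) ^ 4 + 1) := by positivity
          nlinarith [mul_le_mul_of_nonneg_left hKL h0, hN0.le, hL0.le]
        have hstep2 : (1 : ℝ) - 1 / (2 * (u n : ℝ) ^ 2) ≤ ((2 * u n ^ 4 + 1 : ℕ) : ℝ) / L := by
          rw [hLdef]; push_cast
          rw [show ((2 * (u n : ℝ) ^ 4 + 1)) / (2 * (u n : ℝ) ^ 4 + 1 + (u n : ℝ) ^ 2) =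
            1 - (u n : ℝ) ^ 2 / (2 * (u n : ℝ) ^ 4 + 1 + (u n : ℝ) ^ 2) by field_simp; ring]
          have : (u n : ℝ) ^ 2 / (2 * (u n : ℝ) ^ 4 + 1 + (u n : ℝ) ^ 2) ≤ 1 / (2 * (u n : ℝ) ^ 2) := by
            rw [div_le_div_iff₀ (by positivity) (by positivity)]; nlinarith [one_le_pow₀ (M₀ := ℝ) hu1 (n := 2)]
          linarith
        have hstep3 : ((2 * u n ^ 4 + 1 : ℕ) : ℝ) / N ≤ 3 * (u n : ℝ) ^ 4 / 2 ^ u n := by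
          have hN := (two_pow_log_le n).1
          rw [← hNdef] at hN
          have hnum : ((2 * u n ^ 4 + 1 : ℕ) : ℝ) ≤ 3 * (u n : ℝ) ^ 4 := by
            push_cast; nlinarith [one_le_pow₀ (M₀ := ℝ) hu1 (n := 4)]
          exact div_le_div₀ (by positivity) hnum (by positivity) (by exact_mod_cast hN)
        linarith
      · have hN0 : (0 : ℝ) < ((2 * n + 1 : ℕ) : ℝ) := by positivity
        rw [div_le_one hN0]
        have h := Nat.div_mul_le_self (2 * n + 1) (2 * u n ^ 4 + 1 + u n ^ 2)
        have h2 : (2 * n + 1) / (2 * u n ^ 4 + 1 + u n ^ 2) * (2 * u n ^ 4 + 1) ≤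
            (2 * n + 1) / (2 * u n ^ 4 + 1 + u n ^ 2) * (2 * u n ^ 4 + 1 + u n ^ 2) := Nat.mul_le_mul_left _ (by omega)
        exact_mod_cast h2.trans h
    have h := hratio.pow d
    rw [one_pow] at h
    refine h.congr fun n => ?_
    rw [div_pow]
  · -- (vi)
    intro c hc
    have hlim := (tendsto_two_pow_mul_exp_neg_sq d hc).comp hut
    refine squeeze_zero' (Eventually.of_forall fun n => by positivity) (Eventually.of_forall fun n => ?_) hlim
    simp only [Function.comp]
    have hN := (two_pow_log_le n).2
    have hNd : ((2 * n + 1 : ℕ) : ℝ) ^ (4 * d) ≤ (2 : ℝ) ^ (4 * d * (u n + 1)) := by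
      rw [pow_mul' (2 : ℝ)]
      exact pow_le_pow_left₀ (by positivity) (by exact_mod_cast hN.le) _
    have hq : Real.exp (-c * ((u n ^ 2 : ℕ) : ℝ)) = Real.exp (-c * (u n : ℝ) ^ 2) := by push_cast; ring_nf
    rw [hq]
    exact mul_le_mul_of_nonneg_right hNd (Real.exp_pos _).le

end BoxBlocks

end Summit.Ventures.YMGap.RobustBall

end
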